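import Literature.AlgebraicGeometry.Motives.FamiliesVHSTensorDistrib
import Literature.AlgebraicGeometry.Motives.FamiliesVHSIso
import HarnessLib

/-!
# The distributivity isomorphisms `(D₁ ⊕ D₂) ⊗ D₃ ≅ (D₁ ⊗ D₃) ⊕ (D₂ ⊗ D₃)`, `D₁ ⊗ (D₂ ⊕ D₃) ≅ (D₁ ⊗ D₂) ⊕ (D₁ ⊗ D₃)` of VHS data are isometric:
# the norm-bounded and the flat-transport Hodge loci on the two sides coincide

Topic `Literature/AlgebraicGeometry/Motives` (namespace `Literature.AlgebraicGeometry.Motives.VHSData`), lane `lit-hodgefound` (seat `p08`, row g57-#11).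
DEFINITIONS WITH BODIES (`Iso.prodTensorDistrib`, `Iso.tensorProdDistrib`, packaging the mutually inverse morphisms of `Motives/FamiliesVHSTensorDistrib` in
the structure `VHSData.Iso` of `Motives/FamiliesVHSIso`) and THEOREMS (the rationalizations on pure tensors, ISOMETRY for the polarizations
`(Q₁ ⊕ Q₂) ⊗ Q₃` versus `(Q₁ ⊗ Q₃) ⊕ (Q₂ ⊗ Q₃)`, equality of the Cattani–Deligne–Kaplan loci `hodgeLocusOfNormLe` and of the flat-transport Hodge
loci).  No named fact, no instance, no notation (D-0026 net debt `0`).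

PRINTED SOURCES.  P. Deligne, J. Milne, *Tannakian categories*, LNM 900 (1982), §1, 1.15–1.16 (additive tensor categories: `⊗` bi-additive, so it
distributes over `⊕`) and Ex. 2.31 (polarized Hodge structures).  P. Deligne, *Théorie de Hodge II*, 1.1.12, 2.1.  E. Cattani, P. Deligne, A. Kaplan,
*On the locus of Hodge classes*, J. AMS 8 (1995), §1, Thm 1.1 (the loci `S^{(K)}`).  P. Deligne, *Équations différentielles à points singuliers
réguliers*, LNM 163 (1970), I.1.

* §0 private: isometry of a morphism out of `D ⊗ D'` is checked on pure tensors.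
* §1 **`Iso.prodTensorDistrib D₁ D₂ D₃`**, `Hom.appRat_prodTensorDistrib_tmul` (`p ⊗ x ↦ (p₁ ⊗ x, p₂ ⊗ x)` on rational fibres),
  **`Iso.isIsometry_prodTensorDistrib_hom`**, **`hodgeLocusOfNormLe_prod_tensor`**, `setOf_exists_isHodgeAt_transport_mk_tmul`.
* §2 the mirror **`Iso.tensorProdDistrib D₁ D₂ D₃`**, `Hom.appRat_tensorProdDistrib_tmul`, `Iso.isIsometry_tensorProdDistrib_hom`,
  `hodgeLocusOfNormLe_tensor_prod`, `setOf_exists_isHodgeAt_transport_tmul_mk`.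

HONEST SCOPE: as for every `VHSData`, holomorphy ∕ transversality are not recorded.

## References

* [DeligneMilne1982Tannakian] P. Deligne, J. S. Milne, *Tannakian categories*, in LNM 900 (1982), §1, 1.15–1.16, Ex. 2.31.
* [DeligneHodgeII1971] P. Deligne, *Théorie de Hodge II*, Publ. Math. IHÉS 40 (1971), 1.1.12, 2.1.
* [CattaniDeligneKaplan1995] E. Cattani, P. Deligne, A. Kaplan, *On the locus of Hodge classes*, J. Amer. Math. Soc. 8 (1995), §1, Thm 1.1.
* [Deligne1970] P. Deligne, *Équations différentielles à points singuliers réguliers*, LNM 163 (1970), I.1.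
-/

noncomputable section

open CategoryTheory
open scoped TensorProduct

namespace Literature.AlgebraicGeometry.Motives

namespace VHSData

variable {S : Type} [TopologicalSpace S] {k k₁ k₂ k₃ : ℤ}

/-! ## §0 Isometry is checked on pure tensors -/

/-- A morphism out of `D₁ ⊗ D₂` is an isometry as soon as `Q'(φ(x₁ ⊗ x₂), φ(y₁ ⊗ y₂)) = (Q₁ ⊗ Q₂)(x₁ ⊗ x₂, y₁ ⊗ y₂)` (bilinearity). [folklore] -/
private theorem isIsometry_of_forall_tmul {D₁ : VHSData S k₁} {D₂ : VHSData S k₂} {D' : VHSData S (k₁ + k₂)} (φ : Hom (D₁.tensor D₂) D')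
    (h : ∀ (s : S) (x₁ y₁ : D₁.V.fiber s) (x₂ y₂ : D₂.V.fiber s),
      (D'.form s).form (φ.appRat s (x₁ ⊗ₜ[ℚ] x₂)) (φ.appRat s (y₁ ⊗ₜ[ℚ] y₂)) = ((D₁.tensor D₂).form s).form (x₁ ⊗ₜ[ℚ] x₂) (y₁ ⊗ₜ[ℚ] y₂)) :
    φ.IsIsometry := fun s x y => by
  have key : (D'.form s).form.compl₁₂ (φ.appRat s) (φ.appRat s) = ((D₁.tensor D₂).form s).form :=
    TensorProduct.ext' fun x₁ x₂ => TensorProduct.ext' fun y₁ y₂ => h s x₁ y₁ x₂ y₂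
  exact LinearMap.congr_fun (LinearMap.congr_fun key x) y

/-! ## §1 `(D₁ ⊕ D₂) ⊗ D₃ ≅ (D₁ ⊗ D₃) ⊕ (D₂ ⊗ D₃)` -/

section ProdTensor

variable (D₁ D₂ : VHSData S k) (D₃ : VHSData S k₃)

/-- **`(D₁ ⊕ D₂) ⊗ D₃ ≅ (D₁ ⊗ D₃) ⊕ (D₂ ⊗ D₃)`** (the morphisms `Hom.prodTensorDistrib ∕ prodTensorDistribSymm` of `Motives/FamiliesVHSTensorDistrib`,
packaged). [cite: DeligneMilne1982Tannakian, §1, 1.15–1.16] [cite: Deligne1970, I.1] -/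
def Iso.prodTensorDistrib : Iso ((D₁.prod D₂).tensor D₃) ((D₁.tensor D₃).prod (D₂.tensor D₃)) where
  hom := Hom.prodTensorDistrib D₁ D₂ D₃
  inv := Hom.prodTensorDistribSymm D₁ D₂ D₃
  inv_comp_hom := Hom.prodTensorDistribSymm_comp_prodTensorDistrib D₁ D₂ D₃
  hom_comp_inv := Hom.prodTensorDistrib_comp_prodTensorDistribSymm D₁ D₂ D₃

/-- `(Iso.prodTensorDistrib).hom = Hom.prodTensorDistrib`. [cite: Deligne1970, I.1] -/
@[simp] theorem Iso.prodTensorDistrib_hom : (Iso.prodTensorDistrib D₁ D₂ D₃).hom = Hom.prodTensorDistrib D₁ D₂ D₃ := rfl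

/-- `(Iso.prodTensorDistrib).inv = Hom.prodTensorDistribSymm`. [cite: Deligne1970, I.1] -/
@[simp] theorem Iso.prodTensorDistrib_inv : (Iso.prodTensorDistrib D₁ D₂ D₃).inv = Hom.prodTensorDistribSymm D₁ D₂ D₃ := rfl

/-- **The rationalization of `prodTensorDistrib` on a pure tensor: `p ⊗ x ↦ (p₁ ⊗ x, p₂ ⊗ x)`** (the rationalizations of `prodLift`, `φ ⊗ ψ`, `pr₁`,
`pr₂`, `id` are `prod`, `map`, `fst`, `snd`, `id`: `homRat_prod`, `homRat_tensorMap`, `homRat_fst ∕ snd`, `appRat_id`). [cite: Deligne1970, I.1] -/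
theorem Hom.appRat_prodTensorDistrib_tmul (s : S) (p : D₁.V.fiber s × D₂.V.fiber s) (x : D₃.V.fiber s) :
    (Hom.prodTensorDistrib D₁ D₂ D₃).appRat s (p ⊗ₜ[ℚ] x) =
      ((p.1 ⊗ₜ[ℚ] x, p.2 ⊗ₜ[ℚ] x) : (D₁.V.fiber s ⊗[ℚ] D₃.V.fiber s) × (D₂.V.fiber s ⊗[ℚ] D₃.V.fiber s)) := by
  have h := LinearMap.congr_fun (homRat_prod ((Hom.fst D₁ D₂).tensor (Hom.id D₃)) ((Hom.snd D₁ D₂).tensor (Hom.id D₃)) s) (p ⊗ₜ[ℚ] x)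
  have h₁ := LinearMap.congr_fun (homRat_tensorMap (Hom.fst D₁ D₂) (Hom.id D₃) s) (p ⊗ₜ[ℚ] x)
  have h₂ := LinearMap.congr_fun (homRat_tensorMap (Hom.snd D₁ D₂) (Hom.id D₃) s) (p ⊗ₜ[ℚ] x)
  have hf := LinearMap.congr_fun (homRat_fst D₁ D₂ s) p
  have hs := LinearMap.congr_fun (homRat_snd D₁ D₂ s) p
  have hi := LinearMap.congr_fun (Hom.appRat_id D₃ s) x
  refine h.trans (Prod.ext (h₁.trans ?_) (h₂.trans ?_))
  · exact congrArg₂ (fun (a : D₁.V.fiber s) (b : D₃.V.fiber s) => a ⊗ₜ[ℚ] b) hf hi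
  · exact congrArg₂ (fun (a : D₂.V.fiber s) (b : D₃.V.fiber s) => a ⊗ₜ[ℚ] b) hs hi

/-- **`prodTensorDistrib` is an isometry**: `((Q₁ ⊕ Q₂) ⊗ Q₃)(p ⊗ x, q ⊗ y) = (Q₁(p₁,q₁) + Q₂(p₂,q₂)) Q₃(x,y) = ((Q₁ ⊗ Q₃) ⊕ (Q₂ ⊗ Q₃))((p₁ ⊗ x, p₂ ⊗ x),
(q₁ ⊗ y, q₂ ⊗ y))`. [cite: DeligneMilne1982Tannakian, §1, 1.15–1.16 and Ex. 2.31] -/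
theorem Iso.isIsometry_prodTensorDistrib_hom : (Iso.prodTensorDistrib D₁ D₂ D₃).hom.IsIsometry :=
  isIsometry_of_forall_tmul (Hom.prodTensorDistrib D₁ D₂ D₃) fun s p q x y => by
    simp only [Hom.appRat_prodTensorDistrib_tmul, prod_form_form, tensor_form_form_tmul]
    ring

/-- **The norm-bounded Hodge loci of `(D₁ ⊕ D₂) ⊗ D₃` and `(D₁ ⊗ D₃) ⊕ (D₂ ⊗ D₃)` coincide.** [cite: CattaniDeligneKaplan1995, §1, Thm 1.1] -/
theorem hodgeLocusOfNormLe_prod_tensor (p K : ℤ) :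
    ((D₁.prod D₂).tensor D₃).hodgeLocusOfNormLe p K = ((D₁.tensor D₃).prod (D₂.tensor D₃)).hodgeLocusOfNormLe p K :=
  (Iso.prodTensorDistrib D₁ D₂ D₃).hodgeLocusOfNormLe_eq (Iso.isIsometry_prodTensorDistrib_hom D₁ D₂ D₃) p K

/-- **The flat-transport Hodge loci of `(u₁ ⊗ u₃, u₂ ⊗ u₃)` and `(u₁, u₂) ⊗ u₃` coincide.** [cite: CattaniDeligneKaplan1995, §1] -/
theorem setOf_exists_isHodgeAt_transport_mk_tmul (s : S) (p : ℤ) (u₁ : D₁.VZ.fiber s) (u₂ : D₂.VZ.fiber s) (u₃ : D₃.VZ.fiber s) :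
    {t | ∃ γ : Path.Homotopic.Quotient s t, ((D₁.tensor D₃).prod (D₂.tensor D₃)).IsHodgeAt t p
        (((D₁.tensor D₃).prod (D₂.tensor D₃)).VZ.transport γ
          ((u₁ ⊗ₜ[ℤ] u₃, u₂ ⊗ₜ[ℤ] u₃) : (D₁.VZ.fiber s ⊗[ℤ] D₃.VZ.fiber s) × (D₂.VZ.fiber s ⊗[ℤ] D₃.VZ.fiber s)))} =
      {t | ∃ γ : Path.Homotopic.Quotient s t, ((D₁.prod D₂).tensor D₃).IsHodgeAt t p
        (((D₁.prod D₂).tensor D₃).VZ.transport γ (((u₁, u₂) : D₁.VZ.fiber s × D₂.VZ.fiber s) ⊗ₜ[ℤ] u₃))} :=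
  (Iso.prodTensorDistrib D₁ D₂ D₃).setOf_exists_isHodgeAt_transport_eq s p (((u₁, u₂) : D₁.VZ.fiber s × D₂.VZ.fiber s) ⊗ₜ[ℤ] u₃)

end ProdTensor

/-! ## §2 `D₁ ⊗ (D₂ ⊕ D₃) ≅ (D₁ ⊗ D₂) ⊕ (D₁ ⊗ D₃)` -/

section TensorProd

variable (D₁ : VHSData S k₁) (D₂ D₃ : VHSData S k)

/-- **`D₁ ⊗ (D₂ ⊕ D₃) ≅ (D₁ ⊗ D₂) ⊕ (D₁ ⊗ D₃)`** (packaged). [cite: DeligneMilne1982Tannakian, §1, 1.15–1.16] [cite: Deligne1970, I.1] -/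
def Iso.tensorProdDistrib : Iso (D₁.tensor (D₂.prod D₃)) ((D₁.tensor D₂).prod (D₁.tensor D₃)) where
  hom := Hom.tensorProdDistrib D₁ D₂ D₃
  inv := Hom.tensorProdDistribSymm D₁ D₂ D₃
  inv_comp_hom := Hom.tensorProdDistribSymm_comp_tensorProdDistrib D₁ D₂ D₃
  hom_comp_inv := Hom.tensorProdDistrib_comp_tensorProdDistribSymm D₁ D₂ D₃

/-- `(Iso.tensorProdDistrib).hom = Hom.tensorProdDistrib`. [cite: Deligne1970, I.1] -/
@[simp] theorem Iso.tensorProdDistrib_hom : (Iso.tensorProdDistrib D₁ D₂ D₃).hom = Hom.tensorProdDistrib D₁ D₂ D₃ := rfl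

/-- `(Iso.tensorProdDistrib).inv = Hom.tensorProdDistribSymm`. [cite: Deligne1970, I.1] -/
@[simp] theorem Iso.tensorProdDistrib_inv : (Iso.tensorProdDistrib D₁ D₂ D₃).inv = Hom.tensorProdDistribSymm D₁ D₂ D₃ := rfl

/-- **The rationalization of `tensorProdDistrib` on a pure tensor: `x ⊗ p ↦ (x ⊗ p₁, x ⊗ p₂)`.** [cite: Deligne1970, I.1] -/
theorem Hom.appRat_tensorProdDistrib_tmul (s : S) (x : D₁.V.fiber s) (p : D₂.V.fiber s × D₃.V.fiber s) :
    (Hom.tensorProdDistrib D₁ D₂ D₃).appRat s (x ⊗ₜ[ℚ] p) =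
      ((x ⊗ₜ[ℚ] p.1, x ⊗ₜ[ℚ] p.2) : (D₁.V.fiber s ⊗[ℚ] D₂.V.fiber s) × (D₁.V.fiber s ⊗[ℚ] D₃.V.fiber s)) := by
  have h := LinearMap.congr_fun (homRat_prod ((Hom.id D₁).tensor (Hom.fst D₂ D₃)) ((Hom.id D₁).tensor (Hom.snd D₂ D₃)) s) (x ⊗ₜ[ℚ] p)
  have h₁ := LinearMap.congr_fun (homRat_tensorMap (Hom.id D₁) (Hom.fst D₂ D₃) s) (x ⊗ₜ[ℚ] p)
  have h₂ := LinearMap.congr_fun (homRat_tensorMap (Hom.id D₁) (Hom.snd D₂ D₃) s) (x ⊗ₜ[ℚ] p)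
  have hf := LinearMap.congr_fun (homRat_fst D₂ D₃ s) p
  have hs := LinearMap.congr_fun (homRat_snd D₂ D₃ s) p
  have hi := LinearMap.congr_fun (Hom.appRat_id D₁ s) x
  refine h.trans (Prod.ext (h₁.trans ?_) (h₂.trans ?_))
  · exact congrArg₂ (fun (a : D₁.V.fiber s) (b : D₂.V.fiber s) => a ⊗ₜ[ℚ] b) hi hf
  · exact congrArg₂ (fun (a : D₁.V.fiber s) (b : D₃.V.fiber s) => a ⊗ₜ[ℚ] b) hi hs

/-- **`tensorProdDistrib` is an isometry.** [cite: DeligneMilne1982Tannakian, §1, 1.15–1.16 and Ex. 2.31] -/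
theorem Iso.isIsometry_tensorProdDistrib_hom : (Iso.tensorProdDistrib D₁ D₂ D₃).hom.IsIsometry :=
  isIsometry_of_forall_tmul (Hom.tensorProdDistrib D₁ D₂ D₃) fun s x y p q => by
    simp only [Hom.appRat_tensorProdDistrib_tmul, prod_form_form, tensor_form_form_tmul]
    ring

/-- **The norm-bounded Hodge loci of `D₁ ⊗ (D₂ ⊕ D₃)` and `(D₁ ⊗ D₂) ⊕ (D₁ ⊗ D₃)` coincide.** [cite: CattaniDeligneKaplan1995, §1, Thm 1.1] -/
theorem hodgeLocusOfNormLe_tensor_prod (p K : ℤ) :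
    (D₁.tensor (D₂.prod D₃)).hodgeLocusOfNormLe p K = ((D₁.tensor D₂).prod (D₁.tensor D₃)).hodgeLocusOfNormLe p K :=
  (Iso.tensorProdDistrib D₁ D₂ D₃).hodgeLocusOfNormLe_eq (Iso.isIsometry_tensorProdDistrib_hom D₁ D₂ D₃) p K

/-- **The flat-transport Hodge loci of `(u₁ ⊗ u₂, u₁ ⊗ u₃)` and `u₁ ⊗ (u₂, u₃)` coincide.** [cite: CattaniDeligneKaplan1995, §1] -/
theorem setOf_exists_isHodgeAt_transport_tmul_mk (s : S) (p : ℤ) (u₁ : D₁.VZ.fiber s) (u₂ : D₂.VZ.fiber s) (u₃ : D₃.VZ.fiber s) :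
    {t | ∃ γ : Path.Homotopic.Quotient s t, ((D₁.tensor D₂).prod (D₁.tensor D₃)).IsHodgeAt t p
        (((D₁.tensor D₂).prod (D₁.tensor D₃)).VZ.transport γ
          ((u₁ ⊗ₜ[ℤ] u₂, u₁ ⊗ₜ[ℤ] u₃) : (D₁.VZ.fiber s ⊗[ℤ] D₂.VZ.fiber s) × (D₁.VZ.fiber s ⊗[ℤ] D₃.VZ.fiber s)))} =
      {t | ∃ γ : Path.Homotopic.Quotient s t, (D₁.tensor (D₂.prod D₃)).IsHodgeAt t p
        ((D₁.tensor (D₂.prod D₃)).VZ.transport γ (u₁ ⊗ₜ[ℤ] ((u₂, u₃) : D₂.VZ.fiber s × D₃.VZ.fiber s)))} :=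
  (Iso.tensorProdDistrib D₁ D₂ D₃).setOf_exists_isHodgeAt_transport_eq s p (u₁ ⊗ₜ[ℤ] ((u₂, u₃) : D₂.VZ.fiber s × D₃.VZ.fiber s))

end TensorProd

end VHSData

end Literature.AlgebraicGeometry.Motives

end
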